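import Mathlib
import Summits.Ventures.PercRepro2.StarGlue
import Summits.Ventures.PercRepro2.TypedFactor
import Summits.Ventures.PercRepro2.TypedSepThreeSym
import Summits.Ventures.PercRepro2.TypedSplit
import Summits.Ventures.PercRepro2.TypedUntouched
import Summits.Ventures.PercRepro2.HCovTyped
import Summits.Ventures.PercRepro2.OStarGlueStar

/-!
# The typed sums over the two sides of a star (blind cell PercRepro2, mine-2 g39, 2026-08-28;
`proofs/MINE2-GLUE.md` §3, row M2-83 — part II of the gluing lemma)

Generic typed-count bookkeeping, for any kernel: **`typedCount_eq_sum_AB`** — the typed triples of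
`A ∪ B` (disjoint) are the pairs of typed triples of `B` and of `A`, merged over the common
background (a bijection through night-3's `TypedFactor.merge / restr`, `Finset.sum_nbij'`);
**`peel`** — the typed count of a kernel reading one optional edge's value is the `plc` sum over
that edge's placements of the counts with the edge removed (typed edge: night-3's
`typedCount_split`; pinned edge: `typedCount_insert_pinned` then the split; absent edge: one
placement); **`typedCount_star_eq`** — for the star of part I, the typed count over the typed star
edges of a function of the three neighbour sets is its `plc` sum over the placements of the three
slots with their types (`typ`: absent `0`, typed `τ e`, pinned open / closed `3` / `0`).  Own code;
standard axioms.
-/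

namespace Summit.Ventures.PercRepro2

open UnionCluster

namespace CovForm

namespace OStar

open OneTyped Untouched TypedFactor SepThree TypedRed StarGlue

/-! ## The typed triples of `A ∪ B` are the products of the typed triples of the sides -/

section Product

variable {E : Type*} [Fintype E] [DecidableEq E] {R : Type*} [CommRing R]

/-- A conditioned triple sum as a sum over a filtered product. -/
lemma sum3_filter (c : Config E → Config E → Config E → Prop) [∀ x y w, Decidable (c x y w)]
    (f : Config E → Config E → Config E → R) :
    (∑ x : Config E, ∑ y : Config E, ∑ w : Config E, if c x y w then f x y w else 0) =
      ∑ p ∈ (Finset.univ : Finset (Config E × Config E × Config E)).filter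
        (fun p => c p.1 p.2.1 p.2.2), f p.1 p.2.1 p.2.2 := by
  rw [Finset.sum_filter]
  simp only [Fintype.sum_prod_type]

/-- A conditioned six-fold sum as a sum over a filtered product of triples. -/
lemma sum6_filter (cA cB : Config E → Config E → Config E → Prop)
    [∀ x y w, Decidable (cA x y w)] [∀ x y w, Decidable (cB x y w)]
    (g : Config E × Config E × Config E → Config E × Config E × Config E → R) :
    (∑ xb : Config E, ∑ yb : Config E, ∑ wb : Config E, ∑ xa : Config E, ∑ ya : Config E,
        ∑ wa : Config E, if cA xa ya wa ∧ cB xb yb wb then g (xb, yb, wb) (xa, ya, wa) else 0) =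
      ∑ q ∈ (Finset.univ : Finset ((Config E × Config E × Config E) ×
        (Config E × Config E × Config E))).filter
          (fun q => cA q.2.1 q.2.2.1 q.2.2.2 ∧ cB q.1.1 q.1.2.1 q.1.2.2), g q.1 q.2 := by
  rw [Finset.sum_filter]
  simp only [Fintype.sum_prod_type]

omit [Fintype E] in
/-- The typed condition on `A ∪ B` restricts to the `A`-condition on the `A`-restrictions. -/
lemma cond_restr_left {A B : Finset E} {z : Config E} {τ : E → ℕ} {x y w : Config E}
    (h : cond (A ∪ B) z τ x y w) : cond A z τ (restr A z x) (restr A z y) (restr A z w) := by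
  refine ⟨fun e he => ⟨restr_of_not_mem he, restr_of_not_mem he, restr_of_not_mem he⟩,
    fun e he => ?_⟩
  simp only [openCount, restr_of_mem he]
  exact h.2 e (Finset.mem_union_left _ he)

omit [Fintype E] in
/-- The typed condition on `A ∪ B` restricts to the `B`-condition on the `B`-restrictions. -/
lemma cond_restr_right {A B : Finset E} {z : Config E} {τ : E → ℕ} {x y w : Config E}
    (h : cond (A ∪ B) z τ x y w) : cond B z τ (restr B z x) (restr B z y) (restr B z w) := by
  refine ⟨fun e he => ⟨restr_of_not_mem he, restr_of_not_mem he, restr_of_not_mem he⟩,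
    fun e he => ?_⟩
  simp only [openCount, restr_of_mem he]
  exact h.2 e (Finset.mem_union_right _ he)

/-- **The typed count over `A ∪ B` as the double sum over the typed triples of `B` and of `A`**
(the merges of the two sides over the common background). -/
theorem typedCount_eq_sum_AB (A B : Finset E) (hAB : Disjoint A B) (z : Config E) (τ : E → ℕ)
    (K : Config E → Config E → Config E → R) :
    typedCount (A ∪ B) z τ K =
      ∑ xb : Config E, ∑ yb : Config E, ∑ wb : Config E, ∑ xa : Config E, ∑ ya : Config E,
        ∑ wa : Config E, if cond A z τ xa ya wa ∧ cond B z τ xb yb wb then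
          K (merge A B z xa xb) (merge A B z ya yb) (merge A B z wa wb) else 0 := by
  classical
  rw [typedCount_eq_sum_cond, sum3_filter,
    sum6_filter (cond A z τ) (cond B z τ) (fun pb pa => K (merge A B z pa.1 pb.1)
      (merge A B z pa.2.1 pb.2.1) (merge A B z pa.2.2 pb.2.2))]
  refine Finset.sum_nbij'
    (fun p => ((restr B z p.1, restr B z p.2.1, restr B z p.2.2),
      (restr A z p.1, restr A z p.2.1, restr A z p.2.2)))
    (fun q => (merge A B z q.2.1 q.1.1, merge A B z q.2.2.1 q.1.2.1, merge A B z q.2.2.2 q.1.2.2))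
    ?_ ?_ ?_ ?_ ?_
  · rintro ⟨x, y, w⟩ hp
    simp only [Finset.mem_filter, Finset.mem_univ, true_and] at hp ⊢
    exact ⟨cond_restr_left hp, cond_restr_right hp⟩
  · rintro ⟨⟨xb, yb, wb⟩, ⟨xa, ya, wa⟩⟩ hq
    simp only [Finset.mem_filter, Finset.mem_univ, true_and] at hq ⊢
    exact (cond_merge hAB (fun e he => (hq.1.1 e he).1) (fun e he => (hq.1.1 e he).2.1)
      (fun e he => (hq.1.1 e he).2.2) (fun e he => (hq.2.1 e he).1) (fun e he => (hq.2.1 e he).2.1)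
      (fun e he => (hq.2.1 e he).2.2)).2 hq
  · rintro ⟨x, y, w⟩ hp
    simp only [Finset.mem_filter, Finset.mem_univ, true_and] at hp
    simp only [merge_restr (fun e he => (hp.1 e he).1), merge_restr (fun e he => (hp.1 e he).2.1),
      merge_restr (fun e he => (hp.1 e he).2.2)]
  · rintro ⟨⟨xb, yb, wb⟩, ⟨xa, ya, wa⟩⟩ hq
    simp only [Finset.mem_filter, Finset.mem_univ, true_and] at hq
    simp only [restr_merge_left (fun e he => (hq.1.1 e he).1),
      restr_merge_left (fun e he => (hq.1.1 e he).2.1), restr_merge_left (fun e he => (hq.1.1 e he).2.2),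
      restr_merge_right hAB (fun e he => (hq.2.1 e he).1),
      restr_merge_right hAB (fun e he => (hq.2.1 e he).2.1),
      restr_merge_right hAB (fun e he => (hq.2.1 e he).2.2)]
  · rintro ⟨x, y, w⟩ hp
    simp only [Finset.mem_filter, Finset.mem_univ, true_and] at hp
    simp only [merge_restr (fun e he => (hp.1 e he).1), merge_restr (fun e he => (hp.1 e he).2.1),
      merge_restr (fun e he => (hp.1 e he).2.2)]

end Product

/-! ## Peeling the star edges off the `A`-side count -/

section Peel

variable {E : Type*} [Fintype E] [DecidableEq E] {R : Type*} [CommRing R]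

omit [Fintype E] in
/-- Updating at another slot does not change a slot's value. -/
lemma val_updO {s s' : Option E} (h : ∀ e e', s = some e → s' = some e' → e ≠ e')
    (x : Config E) (a : Bool) : val s' (updO s x a) = val s' x := by
  cases s with
  | none => rfl
  | some e =>
    cases s' with
    | none => rfl
    | some e' =>
      simp only [val, updO]
      exact Function.update_of_ne (h e e' rfl rfl).symm a x

omit [Fintype E] in
/-- Erasing another slot and updating the background at it does not change a slot's type. -/
lemma typ_eraseO_updO {s s' : Option E} (h : ∀ e e', s = some e → s' = some e' → e ≠ e')
    (A : Finset E) (z : Config E) (τ : E → ℕ) :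
    typ s' (eraseO s A) (updO s z false) τ = typ s' A z τ := by
  cases s with
  | none => rfl
  | some e =>
    cases s' with
    | none => rfl
    | some e' =>
      have hne : e' ≠ e := (h e e' rfl rfl).symm
      simp only [typ, eraseO, updO, Finset.mem_erase, hne, ne_eq, not_false_eq_true, true_and,
        Function.update_of_ne hne]

/-- **Peeling one slot**: the typed count of a kernel reading a slot's value is the `plc` sum, over
the placements of that slot with its type, of the typed counts with the slot removed. -/
theorem peel (s : Option E) (A : Finset E) (z : Config E) (τ : E → ℕ)
    (K : Bool → Bool → Bool → Config E → Config E → Config E → R) :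
    typedCount A z τ (fun x y w => K (val s x) (val s y) (val s w) x y w) =
      ((plc (typ s A z τ)).map fun c => typedCount (eraseO s A) (updO s z false) τ
        (fun x y w => K c.1 c.2.1 c.2.2 (updO s x c.1) (updO s y c.2.1) (updO s w c.2.2))).sum := by
  cases s with
  | none => simp [val, typ, plc, eraseO, updO]
  | some e =>
    by_cases he : e ∈ A
    · simp only [val, typ, if_pos he, eraseO, updO]
      rw [typedCount_split A e he z τ, sum_bool3_eq_plc]
      refine congrArg List.sum (List.map_congr_left fun c _ => ?_)
      refine typedCount_congr_K _ _ _ fun x y w => ?_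
      simp only [Function.update_self]
    · simp only [val, typ, if_neg he, eraseO, updO]
      rw [← typedCount_insert_pinned A e he z τ, typedCount_split (insert e A) e
        (Finset.mem_insert_self e A), sum_bool3_eq_plc]
      simp only [Function.update_self, Finset.erase_insert he, Finset.erase_eq_of_notMem he]
      refine congrArg List.sum (List.map_congr_left fun c _ => ?_)
      exact typedCount_congr_τ A _
        (fun e' he' => Function.update_of_ne (fun h : e' = e => he (h ▸ he')) _ _) _

end Peel

/-! ## The `A`-side count of the star is the gadget sum -/

section StarCount

variable {V : Type*} {E : Type*} [Fintype E] [DecidableEq E] {R : Type*} [Field R]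
variable {ends : E → Sym2 V} {o a₁ a₂ a₃ b : V} {e₁ e₂ eb : Option E}

omit [Fintype E] in
/-- After the three slots are erased nothing of the star side is left. -/
lemma eraseO_star_eq_empty (hS : Star ends o a₁ a₂ a₃ b e₁ e₂ eb) {A : Finset E}
    (hA : ∀ e ∈ A, o ∈ ends e) : eraseO eb (eraseO e₂ (eraseO e₁ A)) = ∅ := by
  ext e
  simp only [Finset.notMem_empty, iff_false]
  intro he
  have hmem : ∀ {s : Option E} {A' : Finset E}, e ∈ eraseO s A' → e ∈ A' ∧ s ≠ some e := by
    intro s A' h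
    cases s with
    | none => exact ⟨h, by simp⟩
    | some e' =>
      simp only [eraseO, Finset.mem_erase] at h
      exact ⟨h.2, by simpa using h.1.symm⟩
  obtain ⟨h1, hb⟩ := hmem he
  obtain ⟨h2, h2'⟩ := hmem h1
  obtain ⟨h3, h1'⟩ := hmem h2
  rcases hS.all e (hA e h3) with h | h | h
  · exact h1' h
  · exact h2' h
  · exact hb h

/-- **The `A`-side count of the star is the gadget sum**: the typed count over the typed star edges
of a function of the three neighbour sets is the `plc` sum of that function over the placements of
the three slots with their types. -/
theorem typedCount_star_eq (hS : Star ends o a₁ a₂ a₃ b e₁ e₂ eb) {A : Finset E}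
    (hA : ∀ e ∈ A, o ∈ ends e) (z : Config E) (τ : E → ℕ) (g : Nb → Nb → Nb → R) :
    typedCount A z τ (fun x y w => g (nbr e₁ e₂ eb x) (nbr e₁ e₂ eb y) (nbr e₁ e₂ eb w)) =
      ((plc (typ e₁ A z τ)).map fun c₁ => ((plc (typ e₂ A z τ)).map fun c₂ =>
        ((plc (typ eb A z τ)).map fun cb =>
          g (c₁.1, c₂.1, cb.1) (c₁.2.1, c₂.2.1, cb.2.1) (c₁.2.2, c₂.2.2, cb.2.2)).sum).sum).sum := by
  have h12 : ∀ e e', e₁ = some e → e₂ = some e' → e ≠ e' := fun e e' h h' => hS.ne12 h h'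
  have h1b : ∀ e e', e₁ = some e → eb = some e' → e ≠ e' := fun e e' h h' => hS.ne1b h h'
  have h2b : ∀ e e', e₂ = some e → eb = some e' → e ≠ e' := fun e e' h h' => hS.ne2b h h'
  -- first slot
  simp only [nbr]
  rw [peel e₁ A z τ (fun v₁ v₂ v₃ x y w => g (v₁, val e₂ x, val eb x) (v₂, val e₂ y, val eb y)
    (v₃, val e₂ w, val eb w))]
  refine congrArg List.sum (List.map_congr_left fun c₁ _ => ?_)
  simp only [val_updO h12, val_updO h1b]
  -- second slot
  rw [peel e₂ (eraseO e₁ A) (updO e₁ z false) τ (fun v₁ v₂ v₃ x y w => g (c₁.1, v₁, val eb x)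
    (c₁.2.1, v₂, val eb y) (c₁.2.2, v₃, val eb w)), typ_eraseO_updO h12]
  refine congrArg List.sum (List.map_congr_left fun c₂ _ => ?_)
  simp only [val_updO h2b]
  -- third slot
  rw [peel eb (eraseO e₂ (eraseO e₁ A)) (updO e₂ (updO e₁ z false) false) τ
    (fun v₁ v₂ v₃ _ _ _ => g (c₁.1, c₂.1, v₁) (c₁.2.1, c₂.2.1, v₂) (c₁.2.2, c₂.2.2, v₃)),
    typ_eraseO_updO h2b, typ_eraseO_updO h1b, eraseO_star_eq_empty hS hA]
  refine congrArg List.sum (List.map_congr_left fun cb _ => ?_)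
  exact typedCount_empty _ _ _

end StarCount

end OStar

end CovForm

end Summit.Ventures.PercRepro2
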